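import Summits.QuantumFields.YangMills.Theorems.FradkinShenkerFlowFiniteSusceptibilityWeakCouplingRPCauchySchwarz
import HarnessLib

/-!
# OS-seminorm pigeonhole (helper package for `stub_coarseCollarAtomRPFloor` of LINES 2/3, ym-idea-11 g13)

The pigeonhole step of the shared coarse-collar-atom stub (`StubCoarseCollarP`, skeletons «FloorInheritance» on
`OnsetSkewLaw.RPOnsetFloor` 23138 and «MarkovFloorInheritance» on `MarkovAtoms.OnsetFloor` 22956), isolated and PROVED:

* `os_pigeonhole` (pure): if a pair series `Σ' a'ⱼ aᵢ Mⱼᵢ` of two `ℓ¹` coefficient families (masses `≤ K', K`) against a kernel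
  dominated by a product of non-negative bounded "seminorms", `|Mⱼᵢ| ≤ n'ⱼ nᵢ`, is at least `ε > 0`, then some ACTIVE index on one
  of the two sides has seminorm square `≥ ε/(K K')`;
* `crossFloor_of_torusFloor` (STEP S1 of the memo, PROVED): a torus two-point floor `ε ≤ Q2 G r β L s w v` for all large tori
  passes to every odd-torus limit state `μ` as the RANDOM-VARIABLE-LEVEL cross floor
  `ε ≤ Cov_μ(Σ'_x w(s x)·dens_x, Σ'_y v(s y)·dens_y)` (tree `InfiniteVolume.tendsto_Q2` + `covariance_tsum_tsum`);
  `crossFloor_of_onsetFloorQ2` packages it in the shape of the skeletons' residual `OnsetFloorQ2`;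
* `abs_cov_le_osNorm_mul`: the tree's abstract RP Cauchy–Schwarz (`RPCauchySchwarz.covariance_rp_cauchySchwarz`) in seminorm form
  `|Cov(F∘Θ, G)| ≤ ‖F‖_OS ‖G‖_OS`, `‖F‖_OS = √Cov(F∘Θ, F)`, for observables in an RP cone.

Planner ym-idea-11 g13.  HONEST LABEL: helper lemmas; no stub / crux / rung / summit is proved; YM mass gap NOT proved.

LANDING NOTE: this is part 1 (§§ Pigeonhole / RPCS / Expansion) of planner ym-idea-11 g13's HOME file
`pub/ideators/ym-idea-11/g13/OSPigeonhole.lean` v3 (sha ca88f963, 555 l.), split VERBATIM for the 400-line rule; part 2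
(§§ CrossFloor / SmearCone) is `OnsetSkewLawRPOnsetFloorOSPigeonholeCone.lean`.  Landed by width seat ym-line-sfw-p2-w5 g16 on the
planner's GO (cell STATUS 2026-08-29T04:23:44Z); authorship: planner ym-idea-11 g13.
-/

set_option autoImplicit false

noncomputable section

open MeasureTheory ProbabilityTheory
open scoped BigOperators
open Summit.QuantumFields.YangMills.Theorems.FiniteSusceptibilityWeakCoupling.RPCauchySchwarz (covariance_rp_cauchySchwarz)

namespace Summit.QuantumFields.YangMills.Theorems.OnsetSkewLawRPOnsetFloorOSPigeonhole

/-- **OS-seminorm pigeonhole** (pure form). [folklore] -/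
theorem os_pigeonhole {ι κ : Type*} {a : ι → ℝ} {a' : κ → ℝ} {n : ι → ℝ} {n' : κ → ℝ} {M : κ → ι → ℝ}
    {K K' B B' ε : ℝ} (hε : 0 < ε) (hK : 0 < K) (hK' : 0 < K')
    (ha : Summable fun i => |a i|) (ha' : Summable fun j => |a' j|)
    (haK : ∑' i, |a i| ≤ K) (haK' : ∑' j, |a' j| ≤ K')
    (hn : ∀ i, 0 ≤ n i) (hn' : ∀ j, 0 ≤ n' j) (hnB : ∀ i, n i ≤ B) (hnB' : ∀ j, n' j ≤ B')
    (hM : ∀ j i, |M j i| ≤ n' j * n i)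
    (hfloor : ε ≤ ∑' p : κ × ι, a' p.1 * a p.2 * M p.1 p.2) :
    (∃ i, a i ≠ 0 ∧ ε / (K * K') ≤ n i ^ 2) ∨ (∃ j, a' j ≠ 0 ∧ ε / (K * K') ≤ n' j ^ 2) := by
  by_contra hcon
  rw [not_or, not_exists, not_exists] at hcon
  obtain ⟨h1, h2⟩ := hcon
  have h1 : ∀ i, a i ≠ 0 → n i ^ 2 < ε / (K * K') := fun i hi => lt_of_not_ge fun h => h1 i ⟨hi, h⟩
  have h2 : ∀ j, a' j ≠ 0 → n' j ^ 2 < ε / (K * K') := fun j hj => lt_of_not_ge fun h => h2 j ⟨hj, h⟩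
  set η : ℝ := ε / (K * K') with hη
  have hηpos : 0 < η := div_pos hε (mul_pos hK hK')
  set r : ℝ := √η with hr
  have hrpos : 0 < r := Real.sqrt_pos.2 hηpos
  have hrsq : r * r = η := Real.mul_self_sqrt hηpos.le
  -- the seminorm-weighted masses
  set f : ι → ℝ := fun i => |a i| * n i with hf
  set g : κ → ℝ := fun j => |a' j| * n' j with hg
  have hf0 : ∀ i, 0 ≤ f i := fun i => mul_nonneg (abs_nonneg _) (hn i)
  have hg0 : ∀ j, 0 ≤ g j := fun j => mul_nonneg (abs_nonneg _) (hn' j)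
  have hB : 0 ≤ B ∨ IsEmpty ι := by
    by_cases hι : Nonempty ι
    · exact Or.inl ((hn hι.some).trans (hnB _))
    · exact Or.inr (not_nonempty_iff.1 hι)
  have hfs : Summable f := by
    refine Summable.of_nonneg_of_le hf0 (fun i => ?_) (ha.mul_right (max B 0))
    exact mul_le_mul_of_nonneg_left ((hnB i).trans (le_max_left _ _)) (abs_nonneg _)
  have hgs : Summable g := by
    refine Summable.of_nonneg_of_le hg0 (fun j => ?_) (ha'.mul_right (max B' 0))
    exact mul_le_mul_of_nonneg_left ((hnB' j).trans (le_max_left _ _)) (abs_nonneg _)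
  -- termwise: f ≤ r |a|, g ≤ r |a'|
  have hfle : ∀ i, f i ≤ r * |a i| := by
    intro i
    by_cases hi : a i = 0
    · simp [hf, hi]
    · have hni : n i < r := by
        rw [hr, ← Real.sqrt_sq (hn i)]
        exact Real.sqrt_lt_sqrt (sq_nonneg _) (h1 i hi)
      rw [hf, mul_comm r]
      exact mul_le_mul_of_nonneg_left hni.le (abs_nonneg _)
  have hgle : ∀ j, g j ≤ r * |a' j| := by
    intro j
    by_cases hj : a' j = 0
    · simp [hg, hj]
    · have hnj : n' j < r := by
        rw [hr, ← Real.sqrt_sq (hn' j)]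
        exact Real.sqrt_lt_sqrt (sq_nonneg _) (h2 j hj)
      rw [hg, mul_comm r]
      exact mul_le_mul_of_nonneg_left hnj.le (abs_nonneg _)
  have hSg : ∑' j, g j ≤ r * K' :=
    (Summable.tsum_le_tsum hgle hgs (ha'.mul_left r)).trans (by rw [tsum_mul_left]; exact mul_le_mul_of_nonneg_left haK' hrpos.le)
  -- the pair family is dominated by g ⊗ f
  have hgf : Summable fun p : κ × ι => g p.1 * f p.2 := hgs.mul_of_nonneg hfs hg0 hf0
  have hPle : ∀ p : κ × ι, ‖a' p.1 * a p.2 * M p.1 p.2‖ ≤ g p.1 * f p.2 := by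
    intro p
    rw [Real.norm_eq_abs, abs_mul, abs_mul]
    calc |a' p.1| * |a p.2| * |M p.1 p.2| ≤ |a' p.1| * |a p.2| * (n' p.1 * n p.2) :=
          mul_le_mul_of_nonneg_left (hM _ _) (mul_nonneg (abs_nonneg _) (abs_nonneg _))
      _ = g p.1 * f p.2 := by simp only [hf, hg]; ring
  have hPs : Summable fun p : κ × ι => a' p.1 * a p.2 * M p.1 p.2 := Summable.of_norm_bounded hgf hPle
  have hfloor' : ε ≤ (∑' j, g j) * ∑' i, f i := by
    refine hfloor.trans ?_
    rw [hgs.tsum_mul_tsum hfs hgf]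
    exact Summable.tsum_le_tsum (fun p => (le_abs_self _).trans (by simpa [Real.norm_eq_abs] using hPle p)) hPs hgf
  -- case 1: all `a i = 0`
  by_cases hall : ∀ i, a i = 0
  · have : (fun p : κ × ι => a' p.1 * a p.2 * M p.1 p.2) = fun _ => 0 := by
      funext p; simp [hall]
    rw [this, tsum_zero] at hfloor
    exact absurd hfloor (not_le.2 hε)
  -- case 2: some active index gives a strict inequality
  obtain ⟨i₀, hi₀⟩ := not_forall.1 hall
  have hflt : f i₀ < r * |a i₀| := by
    have hni : n i₀ < r := by
      rw [hr, ← Real.sqrt_sq (hn i₀)]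
      exact Real.sqrt_lt_sqrt (sq_nonneg _) (h1 i₀ hi₀)
    rw [hf, mul_comm r]
    exact mul_lt_mul_of_pos_left hni (abs_pos.2 hi₀)
  have hSf : ∑' i, f i < r * K := by
    have hlt : ∑' i, f i < ∑' i, r * |a i| := Summable.tsum_lt_tsum hfle hflt hfs (ha.mul_left r)
    rw [tsum_mul_left] at hlt
    exact hlt.trans_le (mul_le_mul_of_nonneg_left haK hrpos.le)
  have hSg0 : 0 ≤ ∑' j, g j := tsum_nonneg hg0
  have : (∑' j, g j) * ∑' i, f i < ε := by
    calc (∑' j, g j) * ∑' i, f i ≤ (r * K') * ∑' i, f i :=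
          mul_le_mul_of_nonneg_right hSg (tsum_nonneg hf0)
      _ < (r * K') * (r * K) := mul_lt_mul_of_pos_left hSf (mul_pos hrpos hK')
      _ = η * (K * K') := by rw [← hrsq]; ring
      _ = ε := by rw [hη]; field_simp
  linarith

/-- **RP Cauchy–Schwarz in OS-seminorm form**: `|Cov(F∘Θ, G)| ≤ √Cov(F∘Θ,F) · √Cov(G∘Θ,G)` for `F, G` in an RP cone `D`
(hypotheses exactly those of `RPCauchySchwarz.covariance_rp_cauchySchwarz`). [folklore] -/
theorem abs_cov_le_osNorm_mul {Ω : Type*} [MeasurableSpace Ω] {μ : Measure Ω} {Θ : Ω → Ω} [IsFiniteMeasure μ]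
    (hΘm : Measurable Θ) (hΘμ : μ.map Θ = μ) (hΘΘ : ∀ ω, Θ (Θ ω) = ω) {D : (Ω → ℝ) → Prop}
    (hRP : ∀ H : Ω → ℝ, Measurable H → (∃ C, ∀ ω, |H ω| ≤ C) → D H → 0 ≤ ∫ ω, H (Θ ω) * H ω ∂μ)
    (hDadd : ∀ (H K : Ω → ℝ) (t : ℝ), D H → D K → D fun ω => H ω + t * K ω)
    (hDsub : ∀ (H : Ω → ℝ) (c : ℝ), D H → D fun ω => H ω - c)
    {F G : Ω → ℝ} (hF : Measurable F) (hG : Measurable G) (hFb : ∃ C, ∀ ω, |F ω| ≤ C) (hGb : ∃ C, ∀ ω, |G ω| ≤ C)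
    (hDF : D F) (hDG : D G) :
    0 ≤ cov[fun ω => F (Θ ω), F; μ] ∧ 0 ≤ cov[fun ω => G (Θ ω), G; μ] ∧
      |cov[fun ω => F (Θ ω), G; μ]| ≤ √(cov[fun ω => F (Θ ω), F; μ]) * √(cov[fun ω => G (Θ ω), G; μ]) := by
  obtain ⟨h1, h2, h3⟩ := covariance_rp_cauchySchwarz hΘm hΘμ hΘΘ hRP hDadd hDsub hF hG hFb hGb hDF hDG
  refine ⟨h1, h2, ?_⟩
  rw [← Real.sqrt_mul h1, ← Real.sqrt_sq_eq_abs]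
  exact Real.sqrt_le_sqrt h3

section Expansion

variable {Ω : Type*} [MeasurableSpace Ω]

/-- A pointwise-summable countable family of measurable real functions has a measurable sum. [folklore] -/
theorem measurable_tsum_of_summable {ι : Type*} [Countable ι] {f : ι → Ω → ℝ} (hf : ∀ i, Measurable (f i))
    (hs : ∀ ω, Summable fun i => f i ω) : Measurable fun ω => ∑' i, f i ω := by
  refine measurable_of_tendsto_metrizable' (Filter.atTop : Filter (Finset ι))
    (f := fun s : Finset ι => fun ω => ∑ i ∈ s, f i ω) (fun s => Finset.measurable_sum s fun i _ => hf i) ?_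
  exact tendsto_pi_nhds.2 fun ω => (hs ω).hasSum

variable {μ : Measure Ω} [IsProbabilityMeasure μ]

/-- Bounded measurable functions: integrability and the `ℓ¹`-weighted norm-integral bound. [folklore] -/
theorem integral_norm_const_mul_le {X : Ω → ℝ} (hX : Measurable X) {B : ℝ} (hB : ∀ ω, |X ω| ≤ B) (c : ℝ) :
    Integrable (fun ω => c * X ω) μ ∧ ∫ ω, ‖c * X ω‖ ∂μ ≤ |c| * B := by
  have hBnn : ∀ ω, (0 : ℝ) ≤ B := fun ω => (abs_nonneg _).trans (hB ω)
  have hXi : Integrable X μ :=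
    (MemLp.of_bound (p := 2) hX.aestronglyMeasurable B (ae_of_all _ fun ω => by
      rw [Real.norm_eq_abs]; exact hB ω)).integrable one_le_two
  refine ⟨hXi.const_mul c, ?_⟩
  have hle : ∀ ω, ‖c * X ω‖ ≤ |c| * B := fun ω => by
    rw [norm_mul, Real.norm_eq_abs, Real.norm_eq_abs]
    exact mul_le_mul_of_nonneg_left (hB ω) (abs_nonneg _)
  calc ∫ ω, ‖c * X ω‖ ∂μ ≤ ∫ _ω, |c| * B ∂μ :=
        integral_mono (hXi.const_mul c).norm (integrable_const _) hle
    _ = |c| * B := by simp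

/-- **Covariance of two `ℓ¹` series of uniformly bounded observables = the `ℓ¹` pair series of covariances**
(the OS-seminorm bookkeeping for infinite atomic smearings). [folklore] -/
theorem covariance_tsum_tsum {ι κ : Type*} [Countable ι] [Countable κ]
    {a : ι → ℝ} {a' : κ → ℝ} (ha : Summable fun i => |a i|) (ha' : Summable fun j => |a' j|)
    {F : ι → Ω → ℝ} {G : κ → Ω → ℝ} (hF : ∀ i, Measurable (F i)) (hG : ∀ j, Measurable (G j))
    {B : ℝ} (hFb : ∀ i ω, |F i ω| ≤ B) (hGb : ∀ j ω, |G j ω| ≤ B) :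
    cov[fun ω => ∑' j, a' j * G j ω, fun ω => ∑' i, a i * F i ω; μ] =
      ∑' p : κ × ι, a' p.1 * a p.2 * cov[G p.1, F p.2; μ] := by
  -- norms of the coefficient families
  have han : Summable fun i => ‖a i‖ := by simpa [Real.norm_eq_abs] using ha
  have han' : Summable fun j => ‖a' j‖ := by simpa [Real.norm_eq_abs] using ha'
  -- pointwise absolute summability of the two series
  have hYs : ∀ ω, Summable fun i => ‖a i * F i ω‖ := fun ω =>
    Summable.of_nonneg_of_le (fun _ => norm_nonneg _)
      (fun i => by rw [norm_mul, Real.norm_eq_abs, Real.norm_eq_abs]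
                   exact mul_le_mul_of_nonneg_left (hFb i ω) (abs_nonneg _)) (ha.mul_right B)
  have hXs : ∀ ω, Summable fun j => ‖a' j * G j ω‖ := fun ω =>
    Summable.of_nonneg_of_le (fun _ => norm_nonneg _)
      (fun j => by rw [norm_mul, Real.norm_eq_abs, Real.norm_eq_abs]
                   exact mul_le_mul_of_nonneg_left (hGb j ω) (abs_nonneg _)) (ha'.mul_right B)
  -- bounds Σ|a| =: Ka, Σ|a'| =: Ka'
  set Ka : ℝ := ∑' i, |a i| with hKa
  set Ka' : ℝ := ∑' j, |a' j| with hKa'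
  -- the summed observables, their measurability and bounds
  set X : Ω → ℝ := fun ω => ∑' j, a' j * G j ω with hX
  set Y : Ω → ℝ := fun ω => ∑' i, a i * F i ω with hY
  have hXm : Measurable X := measurable_tsum_of_summable (fun j => (hG j).const_mul _) fun ω => (hXs ω).of_norm
  have hYm : Measurable Y := measurable_tsum_of_summable (fun i => (hF i).const_mul _) fun ω => (hYs ω).of_norm
  have hXb : ∀ ω, |X ω| ≤ Ka' * |B| := fun ω => by
    rw [hX]
    refine (Real.norm_eq_abs _ ▸ norm_tsum_le_tsum_norm (hXs ω)).trans ?_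
    calc ∑' j, ‖a' j * G j ω‖ ≤ ∑' j, |a' j| * |B| :=
          Summable.tsum_le_tsum (fun j => by
            rw [norm_mul, Real.norm_eq_abs, Real.norm_eq_abs]
            exact mul_le_mul_of_nonneg_left ((hGb j ω).trans (le_abs_self B)) (abs_nonneg _)) (hXs ω) (ha'.mul_right _)
      _ = Ka' * |B| := by rw [tsum_mul_right]
  have hYb : ∀ ω, |Y ω| ≤ Ka * |B| := fun ω => by
    rw [hY]
    refine (Real.norm_eq_abs _ ▸ norm_tsum_le_tsum_norm (hYs ω)).trans ?_
    calc ∑' i, ‖a i * F i ω‖ ≤ ∑' i, |a i| * |B| :=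
          Summable.tsum_le_tsum (fun i => by
            rw [norm_mul, Real.norm_eq_abs, Real.norm_eq_abs]
            exact mul_le_mul_of_nonneg_left ((hFb i ω).trans (le_abs_self B)) (abs_nonneg _)) (hYs ω) (ha.mul_right _)
      _ = Ka * |B| := by rw [tsum_mul_right]
  have hX2 : MemLp X 2 μ := MemLp.of_bound hXm.aestronglyMeasurable (Ka' * |B|)
    (ae_of_all _ fun ω => by rw [Real.norm_eq_abs]; exact hXb ω)
  have hY2 : MemLp Y 2 μ := MemLp.of_bound hYm.aestronglyMeasurable (Ka * |B|)
    (ae_of_all _ fun ω => by rw [Real.norm_eq_abs]; exact hYb ω)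
  have hG2 : ∀ j, MemLp (G j) 2 μ := fun j => MemLp.of_bound (hG j).aestronglyMeasurable B
    (ae_of_all _ fun ω => by rw [Real.norm_eq_abs]; exact hGb j ω)
  have hF2 : ∀ i, MemLp (F i) 2 μ := fun i => MemLp.of_bound (hF i).aestronglyMeasurable B
    (ae_of_all _ fun ω => by rw [Real.norm_eq_abs]; exact hFb i ω)
  -- (1) the means
  have hmX : μ[X] = ∑' j, a' j * μ[G j] := by
    rw [hX, ← integral_tsum_of_summable_integral_norm (fun j => (integral_norm_const_mul_le (hG j) (hGb j) (a' j)).1)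
      (Summable.of_nonneg_of_le (fun _ => integral_nonneg fun _ => norm_nonneg _)
        (fun j => (integral_norm_const_mul_le (hG j) (hGb j) (a' j)).2) (ha'.mul_right B))]
    exact tsum_congr fun j => integral_const_mul _ _
  have hmY : μ[Y] = ∑' i, a i * μ[F i] := by
    rw [hY, ← integral_tsum_of_summable_integral_norm (fun i => (integral_norm_const_mul_le (hF i) (hFb i) (a i)).1)
      (Summable.of_nonneg_of_le (fun _ => integral_nonneg fun _ => norm_nonneg _)
        (fun i => (integral_norm_const_mul_le (hF i) (hFb i) (a i)).2) (ha.mul_right B))]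
    exact tsum_congr fun i => integral_const_mul _ _
  -- (2) the mixed moment
  have hPint : ∀ p : κ × ι, Integrable (fun ω => (a' p.1 * G p.1 ω) * (a p.2 * F p.2 ω)) μ ∧
      ∫ ω, ‖(a' p.1 * G p.1 ω) * (a p.2 * F p.2 ω)‖ ∂μ ≤ |a' p.1| * |a p.2| * (|B| * |B|) := by
    intro p
    have hm : Measurable fun ω => G p.1 ω * F p.2 ω := (hG p.1).mul (hF p.2)
    have hb : ∀ ω, |G p.1 ω * F p.2 ω| ≤ |B| * |B| := fun ω => by
      rw [abs_mul]
      exact mul_le_mul ((hGb _ ω).trans (le_abs_self B)) ((hFb _ ω).trans (le_abs_self B)) (abs_nonneg _)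
        (abs_nonneg B)
    obtain ⟨h1, h2⟩ := integral_norm_const_mul_le (μ := μ) hm hb (a' p.1 * a p.2)
    have heq : ∀ ω, (a' p.1 * G p.1 ω) * (a p.2 * F p.2 ω) = (a' p.1 * a p.2) * (G p.1 ω * F p.2 ω) :=
      fun ω => by ring
    refine ⟨h1.congr (ae_of_all _ fun ω => (heq ω).symm), ?_⟩
    have heq' : (fun ω => ‖(a' p.1 * G p.1 ω) * (a p.2 * F p.2 ω)‖) =
        fun ω => ‖(a' p.1 * a p.2) * (G p.1 ω * F p.2 ω)‖ := by
      funext ω; rw [heq ω]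
    rw [heq']
    rwa [abs_mul] at h2
  have hdom : Summable fun p : κ × ι => |a' p.1| * |a p.2| * (|B| * |B|) := by
    have := (han'.mul_norm han).mul_right (|B| * |B|)
    simpa only [Real.norm_eq_abs, abs_mul] using this
  have hPsum : Summable fun p : κ × ι => ∫ ω, ‖(a' p.1 * G p.1 ω) * (a p.2 * F p.2 ω)‖ ∂μ :=
    Summable.of_nonneg_of_le (fun _ => integral_nonneg fun _ => norm_nonneg _) (fun p => (hPint p).2) hdom
  have hmXY : μ[X * Y] = ∑' p : κ × ι, a' p.1 * a p.2 * μ[fun ω => G p.1 ω * F p.2 ω] := by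
    have hprod : X * Y = fun ω => ∑' p : κ × ι, (a' p.1 * G p.1 ω) * (a p.2 * F p.2 ω) := by
      funext ω
      simp only [Pi.mul_apply, hX, hY]
      exact tsum_mul_tsum_of_summable_norm (hXs ω) (hYs ω)
    rw [hprod, ← integral_tsum_of_summable_integral_norm (fun p => (hPint p).1) hPsum]
    refine tsum_congr fun p => ?_
    rw [← integral_const_mul]
    exact integral_congr_ae (ae_of_all _ fun ω => by ring)
  -- (3) assemble
  rw [covariance_eq_sub hX2 hY2, hmXY, hmX, hmY]
  have hmGs : Summable fun j => ‖a' j * μ[G j]‖ :=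
    Summable.of_nonneg_of_le (fun _ => norm_nonneg _) (fun j => by
      rw [norm_mul, Real.norm_eq_abs, Real.norm_eq_abs]
      refine mul_le_mul_of_nonneg_left ?_ (abs_nonneg _)
      have := norm_integral_le_of_norm_le_const (μ := μ) (f := G j) (C := |B|)
        (ae_of_all _ fun ω => by rw [Real.norm_eq_abs]; exact (hGb j ω).trans (le_abs_self B))
      simpa [Real.norm_eq_abs] using this) (ha'.mul_right |B|)
  have hmFs : Summable fun i => ‖a i * μ[F i]‖ :=
    Summable.of_nonneg_of_le (fun _ => norm_nonneg _) (fun i => by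
      rw [norm_mul, Real.norm_eq_abs, Real.norm_eq_abs]
      refine mul_le_mul_of_nonneg_left ?_ (abs_nonneg _)
      have := norm_integral_le_of_norm_le_const (μ := μ) (f := F i) (C := |B|)
        (ae_of_all _ fun ω => by rw [Real.norm_eq_abs]; exact (hFb i ω).trans (le_abs_self B))
      simpa [Real.norm_eq_abs] using this) (ha.mul_right |B|)
  rw [tsum_mul_tsum_of_summable_norm hmGs hmFs]
  have hS1 : Summable fun p : κ × ι => a' p.1 * a p.2 * μ[fun ω => G p.1 ω * F p.2 ω] := by
    refine Summable.of_norm_bounded hdom fun p => ?_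
    rw [norm_mul, norm_mul, Real.norm_eq_abs, Real.norm_eq_abs, Real.norm_eq_abs]
    refine mul_le_mul_of_nonneg_left ?_ (mul_nonneg (abs_nonneg _) (abs_nonneg _))
    have := norm_integral_le_of_norm_le_const (μ := μ) (f := fun ω => G p.1 ω * F p.2 ω) (C := |B| * |B|)
      (ae_of_all _ fun ω => by
        rw [Real.norm_eq_abs, abs_mul]
        exact mul_le_mul ((hGb _ ω).trans (le_abs_self B)) ((hFb _ ω).trans (le_abs_self B)) (abs_nonneg _)
          (abs_nonneg B))
    simpa [Real.norm_eq_abs] using this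
  have hS2 : Summable fun p : κ × ι => (a' p.1 * μ[G p.1]) * (a p.2 * μ[F p.2]) :=
    summable_mul_of_summable_norm hmGs hmFs
  rw [← hS1.tsum_sub hS2]
  refine tsum_congr fun p => ?_
  rw [covariance_eq_sub (hG2 p.1) (hF2 p.2)]
  simp only [Pi.mul_apply]
  ring

end Expansion

end Summit.QuantumFields.YangMills.Theorems.OnsetSkewLawRPOnsetFloorOSPigeonhole

end
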